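/-
Copyright (c) 2026 the pub-hodgecm-mathlib formalisation cell (harness21).  Prover seat hodgecm-mathlib-F0P3a-p01 (g34), req620 Track A «(D-RAM) FOUR-FRAME» squad, unit U2H:
the (ρ2b′-X) child (U2H ED. 15 :418) — organ O-Lit brick 2, file (ζ-a) «INTEGRALITY NEAR 1 IN AN ANISOTROPIC UNIT FRAME» (valuation algebra for file (ζ), which pays the
integrality clause 10 of the payer LH4-p14 (g4)'s `SOCKET-hLitA.v2` bf5f165f).  2026-09-04.
-/
import Literature.NumberTheory.Automorphic.UnitaryGroupFormTransport            -- ★ `unitaryGroupOfForm`, `formCongr`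
import Literature.NumberTheory.LocalFields.WildQuadraticDatumNormGradedSteps     -- ★ `WildQuadraticDatum.v_eq_one_of_v_mul_map_eq_one`
import Mathlib.LinearAlgebra.Matrix.Charpoly.Coeff
import HarnessLib

/-!
# Crux `H413`, line LH4 «(D-RAM) FOUR-FRAME» road — unit U2H, (ρ2b′-X), organ O-Lit brick 2, file (ζ-a): INTEGRALITY NEAR `1` IN AN ANISOTROPIC UNIT FRAME

Cell `hodgecm-mathlib` (D-0151), FLOOR 0, crux item H413 = `stmt-HodgeConjecture-24833`, route of record `HCCMUnconditional`; squad F0∕P3c∕LH4; registered stub served: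
`F0P3cDyRamFourFrameU2H.stub_U2H_fixedPointCensus_typeTwo_unit0` ((ρ2b′-X), U2H ED. 15 :418), through file (ζ) `F0P3cDyRamTypeTwoOppositeLiteralWildIntegral`
(clause 10 `∀ i j, |γ₁ i j|_w ≤ 1` of socket (A′) v2 of ★ p857650 `hOrgNV_at_of_literal_and_census`).  THEOREMS ONLY (no `def`, no instance, no notation, no `sorry`);
generic over a field `K` with a valuation `v : K → ℤᵐ⁰` and a ring endomorphism `σ` (`σ² = 1`, `v ∘ σ = v`); lane `--supports stmt-HodgeConjecture-24833 --as helper`.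

WHAT THIS FILE DOES.  Elementary valuation algebra for a `σ`-hermitian unit-diagonal plane `h = diag(d₀, d₁)` (`σd_i = d_i`, `|d_i| = 1`) WITHOUT isotropic vectors
(`∀ s, d₀ + d₁·s·σs ≠ 0`), over a `K` in which every `σ`-fixed `u` with `|u − 1| ≤ |θ|` is a norm `t·σt` (`|θ| ≤ 1`; at a wild ramified quadratic datum `θ = ϖ^{2d−1}`
by ★ `WildQuadraticDatum.exists_mul_map_eq_of_fixed_of_v_sub_one_le_pred`):
* §1 `anisotropy_bound` — THE ANISOTROPY CONSTANT: **`|θ| · max(|y₀|, |y₁|)² ≤ |d₀·y₀σy₀ + d₁·y₁σy₁|`** (if the unit `u := −d₀ ∕ (d₁N(y₁∕y₀))` had `|u − 1| ≤ |θ|` it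
  would be a norm, exhibiting an isotropic vector); `entries_le_one_of_unitary_near_one` — **INTEGRALITY NEAR `1`**: for `x = (a b; c d′) ∈ U(σ, diag(d₀, d₁))` with
  `|a + d′ − 2| ≤ |θ|²` and `|det x − 1| ≤ |θ|²`, every `|x i j| ≤ 1` (the adjoint identities `σa·D = d′`, `σd′·D = a`, `D := det x`, `N(D) = 1`, give
  `(d₀N(a−1) + d₁N(c))·D = d₀·((2−a)(D−1) − (tr x − 2))`, and the anisotropy constant bounds the columns `(a−1, c)`, `(b, d′−1)`; bookkeeping `le_one_of_bounds`).
* §2 `anisotropic_of_frame` — anisotropy from the payer's frame equation `ᵗσ̄P·Φ·P = diag(dg₀) ⊥ (η) ⊥ diag(dg₁)`, `det Φ = −1`, `η ∉ N`: `dg₀dg₁η = −N(det P)`;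
  `trace_eq_and_det_eq_of_charpoly_eq` (`2 × 2`).
HONEST LABEL.  Count-neutral helper algebra; (ρ2b′-X) stays an OPEN prover target; `HC_CM` is proved only modulo the 7 printed citations (2 remaining named inputs:
hLiu418 = `stmt-HodgeConjecture-24832`, h413 = `stmt-HodgeConjecture-24833`) until rung 0 closes.

## References
* [Serre1979] J.-P. Serre, *Local Fields*, GTM 67 (1979), Ch. V §3 Prop. 5, Cor. 2–3 pp. 85–87.
* [Rogawski1990] J. D. Rogawski, *Automorphic Representations of Unitary Groups in Three Variables*, Ann. of Math. Stud. 123 (1990), §3.6 p. 31, §4.9 p. 55.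
* [Jacobowitz1962] R. Jacobowitz, *Hermitian forms over local fields*, Amer. J. Math. 84 (1962), §3.
-/

set_option autoImplicit false

noncomputable section

open Matrix
open Literature.NumberTheory.Automorphic
open scoped MatrixGroups Valued WithZero

namespace Summit.HodgeConjecture.HodgeConjecture.Cruxes.H413.F0P3cDyRamAnisotropicUnitFrameIntegrality

/-! ## §1 Valuation algebra: the anisotropy constant and integrality near `1` -/

section Algebra

/-- The bookkeeping inequality in `ℤᵐ⁰`: `g ≤ 1`, `g·A² ≤ 1`, `g·M² ≤ max ((max 1 A)·e₁) e₂` with `e₁, e₂ ≤ g²` force `M ≤ 1`. -/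
theorem le_one_of_bounds {g A M e₁ e₂ : ℤᵐ⁰} (hg0 : g ≠ 0) (hg1 : g ≤ 1) (hA : g * A ^ 2 ≤ 1)
    (hM : g * M ^ 2 ≤ max (max 1 A * e₁) e₂) (he₁ : e₁ ≤ g ^ 2) (he₂ : e₂ ≤ g ^ 2) : M ≤ 1 := by
  have hgg : g ^ 2 ≤ g := by
    calc g ^ 2 = g * g := pow_two g
      _ ≤ g * 1 := mul_le_mul_right hg1 g
      _ = g := mul_one g
  have hbound : max (max 1 A * e₁) e₂ ≤ g := by
    refine max_le ?_ (he₂.trans hgg)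
    rcases le_total A 1 with hA1 | hA1
    · rw [max_eq_left hA1, one_mul]; exact he₁.trans hgg
    · rw [max_eq_right hA1]
      have hgA : g * A ≤ 1 := by
        calc g * A = g * A * 1 := (mul_one _).symm
          _ ≤ g * A * A := mul_le_mul_right hA1 _
          _ = g * A ^ 2 := by rw [pow_two, mul_assoc]
          _ ≤ 1 := hA
      calc A * e₁ ≤ A * g ^ 2 := mul_le_mul_right he₁ A
        _ = (g * A) * g := by rw [pow_two, ← mul_assoc, mul_comm A g]
        _ ≤ 1 * g := mul_le_mul_left hgA g
        _ = g := one_mul g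
  have h1 : M ^ 2 * g ≤ 1 * g := by
    rw [mul_comm, one_mul]; exact hM.trans hbound
  have h2 : M ^ 2 ≤ 1 := le_of_mul_le_mul_right h1 (zero_lt_iff.2 hg0)
  exact (pow_le_one_iff two_ne_zero).1 h2

variable {K : Type} [Field K] (σ : K →+* K)

/-- The four unitarity equations of `x ∈ U(σ, diag(d₀, d₁))`, entrywise. [cite: Rogawski1990, §3.6 p. 31] -/
theorem unitary_diag_eqs {d₀ d₁ : K} {x : GL (Fin 2) K} (hx : x ∈ unitaryGroupOfForm σ !![d₀, 0; 0, d₁]) :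
    σ ((x : Matrix (Fin 2) (Fin 2) K) 0 0) * d₀ * (x : Matrix (Fin 2) (Fin 2) K) 0 0 +
        σ ((x : Matrix (Fin 2) (Fin 2) K) 1 0) * d₁ * (x : Matrix (Fin 2) (Fin 2) K) 1 0 = d₀ ∧
      σ ((x : Matrix (Fin 2) (Fin 2) K) 0 0) * d₀ * (x : Matrix (Fin 2) (Fin 2) K) 0 1 +
        σ ((x : Matrix (Fin 2) (Fin 2) K) 1 0) * d₁ * (x : Matrix (Fin 2) (Fin 2) K) 1 1 = 0 ∧
      σ ((x : Matrix (Fin 2) (Fin 2) K) 0 1) * d₀ * (x : Matrix (Fin 2) (Fin 2) K) 0 0 +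
        σ ((x : Matrix (Fin 2) (Fin 2) K) 1 1) * d₁ * (x : Matrix (Fin 2) (Fin 2) K) 1 0 = 0 ∧
      σ ((x : Matrix (Fin 2) (Fin 2) K) 0 1) * d₀ * (x : Matrix (Fin 2) (Fin 2) K) 0 1 +
        σ ((x : Matrix (Fin 2) (Fin 2) K) 1 1) * d₁ * (x : Matrix (Fin 2) (Fin 2) K) 1 1 = d₁ := by
  rw [mem_unitaryGroupOfForm_iff] at hx
  have h := fun i j => congr_fun (congr_fun hx i) j
  have e00 := h 0 0; have e01 := h 0 1; have e10 := h 1 0; have e11 := h 1 1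
  simp [Matrix.mul_apply, Fin.sum_univ_two] at e00 e01 e10 e11
  exact ⟨by linear_combination e00, by linear_combination e01, by linear_combination e10, by linear_combination e11⟩

variable [Valued K ℤᵐ⁰]

/-- **THE ANISOTROPY CONSTANT, one column normalised.**  See `anisotropy_bound`. -/
theorem anisotropy_bound_aux (hσσ : ∀ x, σ (σ x) = x) (hvσ : ∀ x, Valued.v (σ x) = Valued.v x)
    {d₀ d₁ θ : K} (hσd₀ : σ d₀ = d₀) (hσd₁ : σ d₁ = d₁) (hd₀ : Valued.v d₀ = 1) (hd₁ : Valued.v d₁ = 1)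
    (hθ : Valued.v θ ≤ 1) (hN : ∀ u : K, σ u = u → Valued.v (u - 1) ≤ Valued.v θ → ∃ t : K, t * σ t = u)
    (han : ∀ s : K, d₀ + d₁ * (s * σ s) ≠ 0) {y₀ y₁ : K} (h10 : Valued.v y₁ ≤ Valued.v y₀) :
    Valued.v θ * Valued.v y₀ ^ 2 ≤ Valued.v (d₀ * (y₀ * σ y₀) + d₁ * (y₁ * σ y₁)) := by
  have hd₀0 : d₀ ≠ 0 := fun h => by rw [h, map_zero] at hd₀; exact zero_ne_one hd₀
  have hd₁0 : d₁ ≠ 0 := fun h => by rw [h, map_zero] at hd₁; exact zero_ne_one hd₁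
  by_cases hy₀ : y₀ = 0
  · have hy₁ : y₁ = 0 := by
      rw [hy₀, map_zero, le_zero_iff] at h10
      exact (map_eq_zero _).1 h10
    simp [hy₀, hy₁]
  have hσy₀ : σ y₀ ≠ 0 := (map_ne_zero σ).2 hy₀
  set r : K := y₁ / y₀ with hr
  have hvr : Valued.v r ≤ 1 := by
    rw [hr, map_div₀]
    exact div_le_one_of_le₀ h10 zero_le
  have key : d₀ * (y₀ * σ y₀) + d₁ * (y₁ * σ y₁) = (y₀ * σ y₀) * (d₀ + d₁ * (r * σ r)) := by
    rw [hr, map_div₀]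
    field_simp
  rw [key, Valuation.map_mul, Valuation.map_mul, hvσ, ← pow_two, mul_comm]
  refine mul_le_mul_right ?_ _
  -- `|θ| ≤ |d₀ + d₁ N(r)|`
  by_contra hlt
  rw [not_le] at hlt
  have hNr1 : Valued.v (r * σ r) ≤ 1 := by
    rw [Valuation.map_mul, hvσ]; exact mul_le_one' hvr hvr
  rcases hNr1.lt_or_eq with hlt1 | heq1
  · have h1 : Valued.v (d₀ + d₁ * (r * σ r)) = Valued.v d₀ :=
      Valuation.map_add_eq_of_lt_left _ (by rw [Valuation.map_mul, hd₁, one_mul, hd₀]; exact hlt1)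
    rw [h1, hd₀] at hlt
    exact lt_irrefl _ (hlt.trans_le hθ)
  · have hNr0 : r * σ r ≠ 0 := fun h => by rw [h, map_zero] at heq1; exact zero_ne_one heq1
    have hr0 : r ≠ 0 := fun h => hNr0 (by rw [h, zero_mul])
    have hden : d₁ * (r * σ r) ≠ 0 := mul_ne_zero hd₁0 hNr0
    have hσr0 : σ r ≠ 0 := (map_ne_zero σ).2 hr0
    set u : K := -d₀ / (d₁ * (r * σ r)) with hu
    have hσu : σ u = u := by
      rw [hu, map_div₀, map_neg, map_mul, map_mul, hσσ, hσd₀, hσd₁, mul_comm (σ r) r]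
    have hu1 : u - 1 = -(d₀ + d₁ * (r * σ r)) / (d₁ * (r * σ r)) := by
      rw [hu]; field_simp; ring
    have hvu : Valued.v (u - 1) ≤ Valued.v θ := by
      rw [hu1, map_div₀, Valuation.map_neg, Valuation.map_mul, hd₁, heq1, one_mul, div_one]
      exact hlt.le
    obtain ⟨t, ht⟩ := hN u hσu hvu
    apply han (r * t)
    calc d₀ + d₁ * (r * t * σ (r * t)) = d₀ + d₁ * (r * σ r) * (t * σ t) := by rw [map_mul]; ring
      _ = d₀ + d₁ * (r * σ r) * u := by rw [ht]
      _ = 0 := by rw [hu]; field_simp; ring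

/-- **THE ANISOTROPY CONSTANT** of the unit-diagonal plane `diag(d₀, d₁)` (`σ`-fixed units) with no isotropic vector (`∀ s, d₀ + d₁·s·σs ≠ 0`), over a valued
field with involution `σ` in which every `σ`-fixed `u` with `|u − 1| ≤ |θ|` is a norm `t·σt`: **`|θ| · max(|y₀|, |y₁|)² ≤ |d₀·y₀·σy₀ + d₁·y₁·σy₁|`**.
[cite: Serre1979, Ch. V §3 Prop. 5, Cor. 2–3 pp. 85–87] [cite: Jacobowitz1962, §3] -/
theorem anisotropy_bound (hσσ : ∀ x, σ (σ x) = x) (hvσ : ∀ x, Valued.v (σ x) = Valued.v x)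
    {d₀ d₁ θ : K} (hσd₀ : σ d₀ = d₀) (hσd₁ : σ d₁ = d₁) (hd₀ : Valued.v d₀ = 1) (hd₁ : Valued.v d₁ = 1)
    (hθ : Valued.v θ ≤ 1) (hN : ∀ u : K, σ u = u → Valued.v (u - 1) ≤ Valued.v θ → ∃ t : K, t * σ t = u)
    (han : ∀ s : K, d₀ + d₁ * (s * σ s) ≠ 0) (y₀ y₁ : K) :
    Valued.v θ * (max (Valued.v y₀) (Valued.v y₁)) ^ 2 ≤ Valued.v (d₀ * (y₀ * σ y₀) + d₁ * (y₁ * σ y₁)) := by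
  have hd₁0 : d₁ ≠ 0 := fun h => by rw [h, map_zero] at hd₁; exact zero_ne_one hd₁
  rcases le_total (Valued.v y₁) (Valued.v y₀) with h | h
  · rw [max_eq_left h]
    exact anisotropy_bound_aux σ hσσ hvσ hσd₀ hσd₁ hd₀ hd₁ hθ hN han h
  · rw [max_eq_right h, add_comm]
    have han' : ∀ s : K, d₁ + d₀ * (s * σ s) ≠ 0 := by
      intro s hs
      by_cases hs0 : s = 0
      · rw [hs0, zero_mul, mul_zero, add_zero] at hs; exact hd₁0 hs
      · have hσs0 : σ s ≠ 0 := (map_ne_zero σ).2 hs0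
        have hN0 : s * σ s ≠ 0 := mul_ne_zero hs0 hσs0
        apply han s⁻¹
        calc d₀ + d₁ * (s⁻¹ * σ s⁻¹) = (d₁ + d₀ * (s * σ s)) / (s * σ s) := by
              rw [map_inv₀]; field_simp; ring
          _ = 0 := by rw [hs, zero_div]
    exact anisotropy_bound_aux σ hσσ hvσ hσd₁ hσd₀ hd₁ hd₀ hθ hN han' h

/-- **INTEGRALITY NEAR `1` IN AN ANISOTROPIC UNIT FRAME.**  For `x = (a b; c d′) ∈ U(σ, diag(d₀, d₁))` as in `anisotropy_bound` (`θ ≠ 0`): if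
`|a + d′ − 2| ≤ |θ|²` and `|det x − 1| ≤ |θ|²` then every entry of `x` has absolute value `≤ 1` (the adjoint identities `σa·D = d′`, `σd′·D = a`
give `(d₀|a−1|²_σ + d₁|c|²_σ)·D = d₀((2−a)(D−1) − (tr x − 2))`, and `anisotropy_bound` bounds the column `(a − 1, c)`). [cite: Rogawski1990, §3.6 p. 31]
[cite: Serre1979, Ch. V §3 Cor. 2–3 pp. 85–87] -/
theorem entries_le_one_of_unitary_near_one (hσσ : ∀ x, σ (σ x) = x) (hvσ : ∀ x, Valued.v (σ x) = Valued.v x)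
    {d₀ d₁ θ : K} (hσd₀ : σ d₀ = d₀) (hσd₁ : σ d₁ = d₁) (hd₀ : Valued.v d₀ = 1) (hd₁ : Valued.v d₁ = 1)
    (hθ0 : θ ≠ 0) (hθ : Valued.v θ ≤ 1) (hN : ∀ u : K, σ u = u → Valued.v (u - 1) ≤ Valued.v θ → ∃ t : K, t * σ t = u)
    (han : ∀ s : K, d₀ + d₁ * (s * σ s) ≠ 0) {x : GL (Fin 2) K} (hx : x ∈ unitaryGroupOfForm σ !![d₀, 0; 0, d₁])
    (ht : Valued.v ((x : Matrix (Fin 2) (Fin 2) K) 0 0 + (x : Matrix (Fin 2) (Fin 2) K) 1 1 - 2) ≤ Valued.v θ ^ 2)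
    (hdet : Valued.v ((x : Matrix (Fin 2) (Fin 2) K).det - 1) ≤ Valued.v θ ^ 2) :
    ∀ i j, Valued.v ((x : Matrix (Fin 2) (Fin 2) K) i j) ≤ 1 := by
  have hd₀0 : d₀ ≠ 0 := fun h => by rw [h, map_zero] at hd₀; exact zero_ne_one hd₀
  have hd₁0 : d₁ ≠ 0 := fun h => by rw [h, map_zero] at hd₁; exact zero_ne_one hd₁
  obtain ⟨e00, e01, e10, e11⟩ := unitary_diag_eqs σ hx
  set a : K := (x : Matrix (Fin 2) (Fin 2) K) 0 0 with ha
  set b : K := (x : Matrix (Fin 2) (Fin 2) K) 0 1 with hb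
  set c : K := (x : Matrix (Fin 2) (Fin 2) K) 1 0 with hc
  set d' : K := (x : Matrix (Fin 2) (Fin 2) K) 1 1 with hd'
  have hDdef : (x : Matrix (Fin 2) (Fin 2) K).det = a * d' - b * c := Matrix.det_fin_two _
  rw [hDdef] at hdet
  -- `N(det x) = 1`, so `|det x| = 1`
  have hND : σ (a * d' - b * c) * (a * d' - b * c) = 1 := by
    have h := congrArg Matrix.det (mem_unitaryGroupOfForm_iff.1 hx)
    rw [Matrix.det_mul, Matrix.det_mul, Matrix.det_transpose, ← RingHom.mapMatrix_apply, ← RingHom.map_det, hDdef,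
      Matrix.det_fin_two_of] at h
    have hdd : d₀ * d₁ - 0 * 0 ≠ 0 := by rw [zero_mul, sub_zero]; exact mul_ne_zero hd₀0 hd₁0
    calc σ (a * d' - b * c) * (a * d' - b * c) = σ (a * d' - b * c) * (d₀ * d₁ - 0 * 0) * (a * d' - b * c) / (d₀ * d₁ - 0 * 0) := by
          field_simp
      _ = 1 := by rw [h, div_self hdd]
  have hvD : Valued.v (a * d' - b * c) = 1 :=
    Literature.NumberTheory.LocalFields.WildQuadraticDatum.v_eq_one_of_v_mul_map_eq_one hvσ (by rw [mul_comm, hND, Valuation.map_one])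
  have hD0 : a * d' - b * c ≠ 0 := fun h => by rw [h, map_zero] at hvD; exact zero_ne_one hvD
  -- the adjoint identities
  have I1 : σ a * (a * d' - b * c) = d' := by
    have h : d₀ * (σ a * (a * d' - b * c) - d') = 0 := by linear_combination d' * e00 - c * e01
    exact sub_eq_zero.1 ((mul_eq_zero.1 h).resolve_left hd₀0)
  have I2 : σ d' * (a * d' - b * c) = a := by
    have h : d₁ * (σ d' * (a * d' - b * c) - a) = 0 := by linear_combination a * e11 - b * e10
    exact sub_eq_zero.1 ((mul_eq_zero.1 h).resolve_left hd₁0)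
  -- the two column lengths of `x − 1`
  have hS₀ : (d₀ * ((a - 1) * σ (a - 1)) + d₁ * (c * σ c)) * (a * d' - b * c) = d₀ * ((2 - a) * (a * d' - b * c - 1) - (a + d' - 2)) := by
    rw [map_sub, map_one]; linear_combination (a * d' - b * c) * e00 - d₀ * I1
  have hS₁ : (d₀ * (b * σ b) + d₁ * ((d' - 1) * σ (d' - 1))) * (a * d' - b * c) = d₁ * ((2 - d') * (a * d' - b * c - 1) - (a + d' - 2)) := by
    rw [map_sub, map_one]; linear_combination (a * d' - b * c) * e11 - d₁ * I2
  have h2 : Valued.v (2 : K) ≤ 1 := by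
    rw [show (2 : K) = 1 + 1 by norm_num]
    exact (Valuation.map_add _ _ _).trans (max_le (le_of_eq (Valuation.map_one _)) (le_of_eq (Valuation.map_one _)))
  have hv2 : ∀ z : K, Valued.v (2 - z) ≤ max 1 (Valued.v z) := fun z =>
    (Valuation.map_sub _ _ _).trans (max_le_max h2 le_rfl)
  have hbound : ∀ z : K, Valued.v ((2 - z) * (a * d' - b * c - 1) - (a + d' - 2)) ≤
      max (max 1 (Valued.v z) * Valued.v (a * d' - b * c - 1)) (Valued.v (a + d' - 2)) := fun z => by
    refine (Valuation.map_sub _ _ _).trans (max_le_max ?_ le_rfl)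
    rw [Valuation.map_mul]
    exact mul_le_mul_left (hv2 z) _
  -- column 0
  have hA0 : Valued.v θ * (max (Valued.v a) (Valued.v c)) ^ 2 ≤ 1 := by
    have h := anisotropy_bound σ hσσ hvσ hσd₀ hσd₁ hd₀ hd₁ hθ hN han a c
    have he : d₀ * (a * σ a) + d₁ * (c * σ c) = d₀ := by linear_combination e00
    rwa [he, hd₀] at h
  have hM0 : Valued.v θ * (max (Valued.v (a - 1)) (Valued.v c)) ^ 2 ≤
      max (max 1 (Valued.v a) * Valued.v (a * d' - b * c - 1)) (Valued.v (a + d' - 2)) := by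
    have h := anisotropy_bound σ hσσ hvσ hσd₀ hσd₁ hd₀ hd₁ hθ hN han (a - 1) c
    have hv : Valued.v (d₀ * ((a - 1) * σ (a - 1)) + d₁ * (c * σ c)) = Valued.v ((2 - a) * (a * d' - b * c - 1) - (a + d' - 2)) := by
      have h1 := congrArg Valued.v hS₀
      rw [Valuation.map_mul, Valuation.map_mul, hvD, mul_one, hd₀, one_mul] at h1
      exact h1
    rw [hv] at h
    exact h.trans (hbound a)
  have hcol0 : max (Valued.v (a - 1)) (Valued.v c) ≤ 1 :=
    le_one_of_bounds (Valuation.ne_zero_iff _ |>.2 hθ0) hθ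
      ((mul_le_mul_right (pow_le_pow_left₀ zero_le (le_max_left _ _) 2) _).trans hA0) hM0 hdet ht
  -- column 1
  have hA1 : Valued.v θ * (max (Valued.v b) (Valued.v d')) ^ 2 ≤ 1 := by
    have h := anisotropy_bound σ hσσ hvσ hσd₀ hσd₁ hd₀ hd₁ hθ hN han b d'
    have he : d₀ * (b * σ b) + d₁ * (d' * σ d') = d₁ := by linear_combination e11
    rwa [he, hd₁] at h
  have hM1 : Valued.v θ * (max (Valued.v b) (Valued.v (d' - 1))) ^ 2 ≤
      max (max 1 (Valued.v d') * Valued.v (a * d' - b * c - 1)) (Valued.v (a + d' - 2)) := by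
    have h := anisotropy_bound σ hσσ hvσ hσd₀ hσd₁ hd₀ hd₁ hθ hN han b (d' - 1)
    have hv : Valued.v (d₀ * (b * σ b) + d₁ * ((d' - 1) * σ (d' - 1))) = Valued.v ((2 - d') * (a * d' - b * c - 1) - (a + d' - 2)) := by
      have h1 := congrArg Valued.v hS₁
      rw [Valuation.map_mul, Valuation.map_mul, hvD, mul_one, hd₁, one_mul] at h1
      exact h1
    rw [hv] at h
    exact h.trans (hbound d')
  have hcol1 : max (Valued.v b) (Valued.v (d' - 1)) ≤ 1 :=
    le_one_of_bounds (Valuation.ne_zero_iff _ |>.2 hθ0) hθ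
      ((mul_le_mul_right (pow_le_pow_left₀ zero_le (le_max_right _ _) 2) _).trans hA1) hM1 hdet ht
  -- conclusion
  have hva : Valued.v a ≤ 1 := by
    have h : a = (a - 1) + 1 := by ring
    rw [h]
    exact (Valuation.map_add _ _ _).trans (max_le ((le_max_left _ _).trans hcol0) (by rw [Valuation.map_one]))
  have hvd' : Valued.v d' ≤ 1 := by
    have h : d' = (d' - 1) + 1 := by ring
    rw [h]
    exact (Valuation.map_add _ _ _).trans (max_le ((le_max_right _ _).trans hcol1) (by rw [Valuation.map_one]))
  intro i j
  fin_cases i <;> fin_cases j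
  · exact hva
  · exact (le_max_left _ _).trans hcol1
  · exact (le_max_right _ _).trans hcol0
  · exact hvd'

end Algebra

/-! ## §2 Generic frame facts: anisotropy from the frame equation; trace and determinant from the characteristic polynomial -/

section Frame

variable {K : Type} [Field K] (σ : K →+* K)

/-- **ANISOTROPY FROM THE FRAME EQUATION.**  If `ᵗσ̄P·Φ·P = diag(dg₀) ⊥ (η) ⊥ diag(dg₁)` (in the payer's `3 × 3` letters) with `det Φ = −1`, `σ dg₁ = dg₁` and `η` NOT a norm
`t·σt`, then the plane `diag(dg₀, dg₁)` has no isotropic vector: `dg₀ + dg₁·s·σs ≠ 0` for every `s` (taking determinants, `dg₀dg₁η = −N(det P)`, so an isotropic `s`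
would exhibit `η = N(det P ∕ (dg₁ s))`). [cite: Jacobowitz1962, §3] [cite: Rogawski1990, §3.6 p. 31] -/
theorem anisotropic_of_frame {Φ : Matrix (Fin 3) (Fin 3) K} (hΦ : Φ.det = -1) (P : GL (Fin 3) K) {dg : Fin 2 → K} {η : K}
    (hfr : formCongr σ P Φ = (!![(Matrix.diagonal dg) 0 0, 0, (Matrix.diagonal dg) 0 1; 0, η, 0; (Matrix.diagonal dg) 1 0, 0, (Matrix.diagonal dg) 1 1] : Matrix (Fin 3) (Fin 3) K))
    (hσd₁ : σ (dg 1) = dg 1) (hηN : ¬ ∃ t : K, t * σ t = η) : ∀ s : K, dg 0 + dg 1 * (s * σ s) ≠ 0 := by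
  intro s hs
  have hB : (!![(Matrix.diagonal dg) 0 0, 0, (Matrix.diagonal dg) 0 1; 0, η, 0; (Matrix.diagonal dg) 1 0, 0, (Matrix.diagonal dg) 1 1] : Matrix (Fin 3) (Fin 3) K).det =
      dg 0 * η * dg 1 := by
    rw [Matrix.det_fin_three]
    simp
  have hdet := congrArg Matrix.det hfr
  rw [hB, Matrix.det_mul, Matrix.det_mul, Matrix.det_transpose, ← RingHom.mapMatrix_apply, ← RingHom.map_det, hΦ] at hdet
  -- `hdet : -1 * (σ p * p) = dg 0 * η * dg 1` up to ring normalisation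
  set p : K := (P : Matrix (Fin 3) (Fin 3) K).det with hp
  have hp0 : p ≠ 0 := by
    have hu : IsUnit (P : Matrix (Fin 3) (Fin 3) K).det := by rw [← Matrix.isUnit_iff_isUnit_det]; exact Units.isUnit P
    exact hu.ne_zero
  have hkey : dg 0 * dg 1 * η = -(σ p * p) := by rw [hp]; linear_combination -hdet
  have hdg0 : dg 0 = -(dg 1 * (s * σ s)) := by linear_combination hs
  have hs0 : s ≠ 0 := by
    intro h0
    rw [h0, zero_mul, mul_zero, neg_zero] at hdg0
    rw [hdg0, zero_mul, zero_mul] at hkey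
    exact mul_ne_zero ((map_ne_zero σ).2 hp0) hp0 (neg_eq_zero.1 hkey.symm)
  have hd1 : dg 1 ≠ 0 := by
    intro h0
    rw [h0, mul_zero, zero_mul] at hkey
    exact mul_ne_zero ((map_ne_zero σ).2 hp0) hp0 (neg_eq_zero.1 hkey.symm)
  have hσs0 : σ s ≠ 0 := (map_ne_zero σ).2 hs0
  refine hηN ⟨p / (dg 1 * s), ?_⟩
  rw [map_div₀, map_mul, hσd₁]
  have hden : dg 1 * s * (dg 1 * σ s) ≠ 0 := mul_ne_zero (mul_ne_zero hd1 hs0) (mul_ne_zero hd1 hσs0)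
  rw [div_mul_div_comm, div_eq_iff hden]
  linear_combination hkey - (dg 1 * η) * hdg0

/-- Equal characteristic polynomials of `2 × 2` matrices have equal traces and determinants. -/
theorem trace_eq_and_det_eq_of_charpoly_eq {R : Type} [CommRing R] {M N : Matrix (Fin 2) (Fin 2) R} (h : M.charpoly = N.charpoly) :
    M.trace = N.trace ∧ M.det = N.det := by
  refine ⟨?_, ?_⟩
  · rw [Matrix.trace_eq_neg_charpoly_coeff, Matrix.trace_eq_neg_charpoly_coeff, h]
  · rw [Matrix.det_eq_sign_charpoly_coeff, Matrix.det_eq_sign_charpoly_coeff, h]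

end Frame

end Summit.HodgeConjecture.HodgeConjecture.Cruxes.H413.F0P3cDyRamAnisotropicUnitFrameIntegrality

end
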